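import Literature.MathematicalPhysics.QuantumFieldTheory.QCDPhaseQuenchedPositivity

/-!
Candidate ITEM TEXTS (tree vocabulary only) for the three residual laws of line `Sketch` of crux
stmt-QuantumFields-9150 — for the planner (LEAD-c1.md, "Recommended next").  Everything is unfolded:
`a_k = exp(-(k+1))`, `β_k = afBeta N_f 1 a_k`, `Z_k = (log a_k⁻²)^{massExponent N_f}`, volume floor
`L⁰_k = ⌈log(k+2)/a_k⌉₊`, threshold `thr N_f δ k` = `sInf` of the good floors of the (ii)-certificate.
-/

open MeasureTheory Filter
open Literature.MathematicalPhysics.QuantumFieldTheory Literature.MathematicalPhysics.QuantumLattice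
  Literature.Probability.LatticeModels

namespace Summit.QuantumFields.QCD.Cruxes.MobilityGap.CandidateTexts

/-- The phase-quenched `s`-moment (verbatim the crux's ratio). -/
noncomputable def pqMoment (Nf : ℕ) (β : ℝ) (mq : Fin Nf → ℝ) (S : ℕ) (f : Fin Nf) (v : Site 4) (s : ℝ) : ℝ :=
  (∫ U : GaugeConfig 4 (2 * S + 1) (Matrix.specialUnitaryGroup (Fin 3) ℂ),
      ‖(diracMatrix U mq).det‖ *
        (∑ a : Fin 3, ∑ i : Fin 4, ∑ b : Fin 3, ∑ j : Fin 4,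
          ‖(diracMatrix U mq)⁻¹ (quarkEquiv (f, (Torus.proj (2 * S + 1) 0, a, i)))
            (quarkEquiv (f, (Torus.proj (2 * S + 1) v, b, j)))‖) ^ s
      ∂(wilsonMeasure (fundamentalRep (Fin 3)) β)) /
    (∫ U : GaugeConfig 4 (2 * S + 1) (Matrix.specialUnitaryGroup (Fin 3) ℂ),
      ‖(diracMatrix U mq).det‖ ∂(wilsonMeasure (fundamentalRep (Fin 3)) β))

/-- The (ii)-threshold of the line, fully unfolded (`thrMass N_f δ k` of `Lines/Sketch.lean`). -/
noncomputable def thr (Nf : ℕ) (δ : ℝ) (k : ℕ) : ℝ :=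
  sInf {u : ℝ | -1 ≤ u ∧ ∀ t : Fin Nf → ℝ, (∀ f, u ≤ t f) →
    (∀ f g, |t f - t g| ≤ (k : ℝ) * Real.exp (-((k : ℝ) + 1)) /
        Real.log (1 / Real.exp (-((k : ℝ) + 1)) ^ 2) ^ massExponent Nf) →
    ∀ S : ℕ, ⌈Real.log ((k : ℝ) + 2) / Real.exp (-((k : ℝ) + 1))⌉₊ ≤ S →
      ∀ (f : Fin Nf) (v : Site 4), v ∈ box 4 S →
        pqMoment Nf (afBeta Nf 1 (Real.exp (-((k : ℝ) + 1)))) t S f v (1 / 2) ≤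
          Real.exp δ * Real.exp (-(δ * (Real.exp (-((k : ℝ) + 1)) * ‖v‖)))}

/-- LAW 1 (= `stub_lightChannel`, already tree vocabulary): typical-configuration light channel. -/
def TypicalLightChannel (Nf : ℕ) : Prop :=
  ∃ r : ℝ, ∀ᶠ k : ℕ in atTop, ∃ x : ℝ, -1 < x ∧
    ∃ (f : Fin Nf) (c π₀ : ℝ), 0 < c ∧ 0 < π₀ ∧ ∃ S₀ : ℕ, ∀ S : ℕ, S₀ ≤ S → ∀ n : ℕ, n ≤ S →
      π₀ ≤ (qcdLatticeMeasure (2 * S + 1) (afBeta Nf 1 (Real.exp (-((k : ℝ) + 1))))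
          (fun _ : Fin Nf => x)).real
        {U | c * Real.exp (-(r * (Real.exp (-((k : ℝ) + 1)) * n))) ≤
          ∑ a : Fin 3, ∑ i : Fin 4, ∑ b : Fin 3, ∑ j : Fin 4,
            ‖(diracMatrix U fun _ : Fin Nf => x)⁻¹ (quarkEquiv (f, (Torus.proj (2 * S + 1) 0, a, i)))
              (quarkEquiv (f, (Torus.proj (2 * S + 1) (Pi.single 0 (n : ℤ)), b, j)))‖}

/-- LAW 2 (= `stub_lower` unfolded): clause (iii) in the renormalised window above the threshold. -/
def LowerAtThreshold (Nf : ℕ) : Prop :=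
  ∀ᶠ δ in atTop, ∀ M : ℝ, 0 < M → ∃ s c₀ C₁ p : ℝ, 0 < s ∧ s < 1 ∧ 0 < c₀ ∧ ∀ᶠ k : ℕ in atTop,
    -1 < thr Nf δ k → ∀ t : Fin Nf → ℝ, (∀ f, thr Nf δ k < t f) →
      (∀ f, t f ≤ thr Nf δ k + Real.exp (-((k : ℝ) + 1)) * M /
          Real.log (1 / Real.exp (-((k : ℝ) + 1)) ^ 2) ^ massExponent Nf) →
        ∀ S : ℕ, ⌈Real.log ((k : ℝ) + 2) / Real.exp (-((k : ℝ) + 1))⌉₊ ≤ S → ∀ (f : Fin Nf) (n : ℕ), n ≤ S →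
          c₀ * Real.exp (-(C₁ * (Real.exp (-((k : ℝ) + 1)) * n) + p * Real.log (n + 1))) ≤
            pqMoment Nf (afBeta Nf 1 (Real.exp (-((k : ℝ) + 1)))) t S f (Pi.single 0 (n : ℤ)) s

/-- LAW 3 (= `stub_extinct` unfolded): deep crossers extinct at some admissible scheme volume. -/
def ExtinctAtThreshold (Nf : ℕ) : Prop :=
  ∃ L : ℕ → ℕ, Tendsto (fun k : ℕ => Real.exp (-((k : ℝ) + 1)) * (L k : ℝ)) atTop atTop ∧
    (∀ᶠ k : ℕ in atTop, ⌈Real.log ((k : ℝ) + 2) / Real.exp (-((k : ℝ) + 1))⌉₊ ≤ L k) ∧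
    ∀ᶠ δ in atTop, ∀ M : ℝ, 0 < M → ∀ᶠ k : ℕ in atTop, -1 < thr Nf δ k → ∀ t : Fin Nf → ℝ,
      (∀ f, thr Nf δ k < t f) →
      (∀ f, t f ≤ thr Nf δ k + Real.exp (-((k : ℝ) + 1)) * M /
          Real.log (1 / Real.exp (-((k : ℝ) + 1)) ^ 2) ^ massExponent Nf) →
        (∫ U : GaugeConfig 4 (2 * L k + 1) (Matrix.specialUnitaryGroup (Fin 3) ℂ),
            (∑ f : Fin Nf, (Multiset.countP (fun z : ℂ => z.im = 0 ∧ z.re < -t f)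
              (wilsonDirac (fundamentalRep (Fin 3)) U 0 1).charpoly.roots : ℝ)) *
              ∏ f : Fin Nf, ‖fermionDet (wilsonDirac (fundamentalRep (Fin 3)) U (t f) 1)‖
            ∂(wilsonMeasure (d := 4) (L := 2 * L k + 1) (fundamentalRep (Fin 3))
              (afBeta Nf 1 (Real.exp (-((k : ℝ) + 1)))))) /
          (∫ U : GaugeConfig 4 (2 * L k + 1) (Matrix.specialUnitaryGroup (Fin 3) ℂ),
            ∏ f : Fin Nf, ‖fermionDet (wilsonDirac (fundamentalRep (Fin 3)) U (t f) 1)‖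
            ∂(wilsonMeasure (d := 4) (L := 2 * L k + 1) (fundamentalRep (Fin 3))
              (afBeta Nf 1 (Real.exp (-((k : ℝ) + 1)))))) ≤ 1 / 4

end Summit.QuantumFields.QCD.Cruxes.MobilityGap.CandidateTexts
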